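import Literature.MathematicalPhysics.QuantumFieldTheory.Balaban1983to89.B11Ineq98W80LatticeFree
import Literature.MathematicalPhysics.QuantumFieldTheory.Balaban1983to89.B11Eq98V0LettersLatticeUniform
import Literature.MathematicalPhysics.QuantumFieldTheory.Balaban1983to89.B11Eq28JcurWindow
import HarnessLib

/-!
# Route `UnitScaleTilt`, crux K1 child «MinimiserStabilityRegPr» (stmt-QuantumFields-19200), stub `stub_existenceMinimalOrbit` (EX), route (α) —
# (S2)-prop4: THE `prop4` FIELD OF THE T³ `SectEDatum` IN N06 CURRENCY — [Balaban1985Variational] Proposition 4 (97)–(98) for the typed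
# `W = (δ/δA′)V` (`B11Eq80Current.W80`) AT THE PAIR `(H̃_{1,k}, C_k)` = (`B11Eq103H1Complex.H1LatticeCLM`, `B11Eq44CLetterTower.Cck`) on the tower lattice
# `towerP L m k`, with LATTICE-FREE `(C₄, R′)`, read at `d = 3` for rung R3

Cell `ym3-torus`, width seat `ym-ust-20520-w4` (gen 2; OWNER RULING g25-№1 ADDENDUM 2 (b) «`prop4` is NOT an independent node … supplied INSIDE by
`exists_quadAnalytic_W80_latticeFree` + `quadAnalytic_curV0_lattice_uniform`», DE-CONFLICT 2026-08-28T01:54Z (2)(b) «the lattice-free discharge of `hW` … is the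
NEXT file», assignment 02:06:43Z∕02:06:53Z).  YM₃ on T³ is a ladder rung (R3), NOT the Clay problem; nothing here is a claim about the stub, the crux, d = 4
or the mass gap.  `--supports stmt-QuantumFields-19200 --as helper`; count-neutral.

THE PRINT.  [Balaban1985Variational] Prop. 4 p. 292–293: *«The functional derivative of V(A′) is an analytic function on this space, and satisfies the
estimate … |((δ/δA′)V)(A′)|₍₋₃₎ ≦ C₄(max{|A′|₍₋₁₎, |∇A′|₍₋₂₎})², (98) … The constants a₃, C₄ depend on d and L only.»*  In the tree the Sect. E datum
`B11Prop6Concrete.SectEDatum d Pd 𝔸 L η β B₀ C₄ a₃ B₃ α` carries this as the FIELD `prop4 : ∀ c, Adm c → Prop4Hyp (W c) C₄ a₃`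
(`B11Prop6Scheme.Prop4Hyp` = the quadratic bound on `‖Y‖ < a₃` ∧ `DifferentiableOn ℂ` there), consumed by `exists_solution_concrete` as `hW : QuadAnalytic W C₄ a₃`
(★w2-19200 g2's `Prop7SectET3Objects.prop6_T3` binds exactly this `hW`, DISPLAYED).

WHAT THIS FILE PROVES (sorry-free; no definition; composition BY NAME; [folklore] bookkeeping except where cited).
* §1 `prop4Hyp_of_quadAnalytic_of_analyticOnNhd` — `QuadAnalytic W C R ∧ AnalyticOnNhd ℂ W {‖Y‖ < R} ⟹ Prop4Hyp W C R` (the packaging; `.quadAnalytic` recovers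
  the `hW` of `exists_solution_concrete`).
* §2 **`exists_prop4Hyp_W80_latticeFree`** — `B11Ineq98W80LatticeFree.exists_quadAnalytic_W80_latticeFree` (pub-balaban NE9 leaf-01 g97) RE-PACKAGED AS THE
  `SectEDatum.prop4`-SHAPED CONCLUSION: `∃ α₁ j₁ B δ` BEFORE the lattice (height `k = n+1`, spacing `η` with `ηL^{n+1} = 1`, periods `m`), then for every background
  `U` of the tower lattice `towerP L m (n+1)` and every datum of the displayed rows,
  `Prop4Hyp (W80 ρ τc U₀ H̃_{1,k} C_k ε_C J Δ_π) C₄ R′` with the CLOSED-FORM lattice-free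
  `C₄ = C4W M_ρ M_τ M_J M_Δ b C₂(d, α₀) ℓ θ₃ θ_E C_V R′` (`ℓ = (1 − 4bC₂(ε_C + a_C))⁻¹`, `θ_E = 2ϖΘΓℓ`, `θ₃ = (2ℓ+1)ϖΘΓ/a_C`, `Θ = M_φBM_φ′·d·K_d(δ)`,
  `Γ = C₃(d, L)·2^d·2d`).  Stated for every `d ≥ 1`; rung R3 reads it at `d = 3` (the substitution is free — (S0)-B (N4)).
  THE ROWS, in ★w2-20520 g2's `PROP4-FIT-CENSUS-w2g2.md` numbering (all DISPLAYED verbatim as in the source theorem):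
  CAR (#6–8, #17, #27: `n, η, c₀, c₁, m`, the background `U` on `Bond d (towerP L m (n+1))`, the (115) carrier data `lev₀, κ′, lev₁, Dc, levB`, the W-slot's
  background `U₀`); CLASS (#9 `‖U b − 1‖ ≤ αη`, #10 `‖U(∂p) − 1‖ ≤ αη²` ∕ `h52`, #11 bond-gradient window, #12 tower regularity `αU, hreg, εU`, #16 current window
  `‖J_μ(y)‖ ≤ j₀ ≤ j₁`) — THE CLASS-TRANSFER FACE OF N06(d = 3) (RULING g25-№2 §1: global small field `‖U b − 1‖ ≤ αη` vs EX's (14)∕(3.35) local class with holonomy);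
  N06 (#14 positivity of `Δ′_a, Δ_a, G` = [Balaban1985BackgroundPropagators] Thm 3.11, #19 the Sect. C regime `Regime H̃_{1,k} 0 C_k b 0 C₂ ρ′ 0 a_C ε_C` whose `b`
  is the Thm 3.12 letter `norm_H₁`, #25 `‖Δ_π‖ ≤ M_Δ` = (3.132)); ABS∕1L (#1–5, #13, #15, #18, #20–24, #26).
* §3 **`exists_prop4Hyp_W80_latticeFree_V0Jcur`** — the same at the SectEDatum's own carrier (`κ′ := Bond × Fin d`, `Dc := nabla115 η U`, `U₀ := U`, `J := Jcur U`)
  with the TREE rows DISCHARGED by name: #22 the V₀-group's slot by `B11Eq98V0LettersLatticeUniform.curV0_quadBound_lattice_uniform` (`R_V = 1/16`, `C_V` closed-form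
  in `(d, ω, Ω, M_ρ, M_τ)` under `α ≤ 1`, for a tracial ⋆-compatible contractive `τc`), #24 `‖Jcur U‖₍₋₃₎ ≤ ω³` by `B11Eq28JcurWindow` from the current window #16
  (`j₁ ≤ 1`); exported thresholds `min α₁ 1`, `min j₁ 1`.
HONEST LABEL (OWNER 02:06:43Z).  This file moves `prop4` from «displayed field» to «displayed N06 currency», nothing more: the CLASS rows displayed ARE the
class-transfer face of N06(d = 3); `b` (#19) and `M_Δ` (#25) are N06's own letters; nothing of [Balaban1985BackgroundPropagators] Sect. 3 is proved here.  The
pair `(H̃_{1,k}, C_k)` lives on the TOWER lattice `towerP L m (n+1)`; the identification with the route's `F.P K` ∕ `periodsT3 F K` (★w5-20520 `Prop7SectET3Transport`,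
★w3-20520 `Prop7SectET3Members`) is NOT made here.  Constants crude (the source's); NOT print's `C₄(d, L)` valued.

References: T. Bałaban, CMP 102 (1985) 277–309 [Balaban1985Variational] (Prop. 4 (97)–(98) pp.292–293, (73) p.289, (86)–(89) p.291, (28) p.282, (115) p.294);
CMP 99 (1985) 389–434 [Balaban1985BackgroundPropagators] (Thm 3.11 p.416, (3.126) p.420, Thm 3.12 p.423, (3.132) p.423, (3.35)–(3.36) p.396);
CMP 98 (1985) 17–51 [Balaban1985Averaging] (Prop. 2 p.26, Prop. 5 (157) p.42).
-/

noncomputable section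

open Metric Set
open scoped InnerProductSpace ComplexConjugate BigOperators

namespace Summit.QuantumFields.YangMills.Theorems.Prop7SectET3Prop4

open Literature.MathematicalPhysics.QuantumFieldTheory.Balaban1983to89
open B11Eq103H1Complex (SiteL2K BondL2K H1LatticeCLM)
open B11Eq115Space
open B11Eq174Chart (Regime)
open B11Prop6Scheme (Prop4Hyp)
open B13Contraction113 (QuadAnalytic)
open B4Sect5Torus (TSite)
open B4Sect5Proof (latticeConst)
open B9SectCLatticeCarrier (Bond unshift)
open B7Prop1Explicit (U1 Wcx boxVec)
open B7Prop2Explicit (pdev AvgClosed C0 c2')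
open B7Prop3Flat (c3)
open B7Prop5GeneralLevels (thetaGen C3Gen)
open B9Eq310DeltaPrime (plaqHolU)
open B9Eq310HessianOperator (adTransportW)
open B9Eq315QTorus (perCfg cornerSite)
open B9Eq315QTower (towerP UlevOf)
open B9Eq326OperatorTower (QkW laplaceAk)
open B9Eq324DeltaPrimeATower (laplacePrimeAk)
open B9Eq3119DeltaPiTower (laplaceAkPi)
open B11Eq44COperatorTower (C2T)
open B11Eq44CLetterTower (Cck)
open B11Eq80Current (W80)
open B11Eq63V0GroupCurrent (curV0)
open B11Eq98CurrentSlot (C4W Jcur)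
open B11Eq111FrakG (nabla115)
open B11Ineq98W80LatticeFree (exists_quadAnalytic_W80_latticeFree)
open B11Eq98V0LettersLatticeUniform (curV0_quadBound_lattice_uniform)
open B11Eq28JcurWindow (norm_Jcur_le_of_window levWeight_three_le)

/-! ## §1 Packaging: the two W-slot clauses ⟹ `Prop4Hyp` -/

/-- **Packaging.**  The two W-slot clauses produced by the NE9 lineage — the (98)-type quadratic bound with line-analyticity (`QuadAnalytic W C R`) and
Fréchet analyticity on the open ball (`AnalyticOnNhd ℂ W {‖Y‖ < R}`) — give `B11Prop6Scheme.Prop4Hyp W C R`, the shape of the field `SectEDatum.prop4`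
(quadratic bound + `DifferentiableOn ℂ` on the ball). [folklore] -/
theorem prop4Hyp_of_quadAnalytic_of_analyticOnNhd {𝒴 𝒵 : Type*} [NormedAddCommGroup 𝒴] [NormedSpace ℂ 𝒴] [NormedAddCommGroup 𝒵] [NormedSpace ℂ 𝒵]
    {W : 𝒴 → 𝒵} {C R : ℝ} (hq : QuadAnalytic W C R) (han : AnalyticOnNhd ℂ W {Y : 𝒴 | ‖Y‖ < R}) : Prop4Hyp W C R where
  quad := hq.quad
  differentiableOn := han.differentiableOn

/-! ## §2 Proposition 4 for `W80` at the tower pair `(H̃_{1,k}, C_k)` with lattice-free `(C₄, R′)`, `Prop4Hyp`-shaped — all rows displayed -/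

section Displayed

variable {d : ℕ} (hd : 1 ≤ d) (L : ℕ) [NeZero L] (hL : 1 ≤ L) (hL3 : 3 ≤ L)
  {𝔸 : Type*} [NormedRing 𝔸] [NormedAlgebra ℂ 𝔸] [CompleteSpace 𝔸] [NormOneClass 𝔸] [StarRing 𝔸] [NormedStarGroup 𝔸] [StarModule ℂ 𝔸]
  {W : Type*} [NormedAddCommGroup W] [InnerProductSpace ℂ W] [FiniteDimensional ℂ W] (φ : W ≃ₗ[ℂ] 𝔸)
  {Mφ Mφ' : ℝ} (hMφ : 0 ≤ Mφ) (hMφ' : 0 ≤ Mφ') (hφ : ∀ w, ‖φ w‖ ≤ Mφ * ‖w‖) (hφ' : ∀ X, ‖φ.symm X‖ ≤ Mφ' * ‖X‖) (hstar : ∀ X : 𝔸, ‖star X‖ ≤ ‖X‖)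
  {a : ℝ} (ha : 0 < a) {a' : ℝ} (ha' : 0 < a') {ϱ : ℝ} (hϱ0 : 0 ≤ ϱ) (hϱ1 : ϱ < 1)
  (τ : 𝔸 →ₗ[ℂ] ℂ) {Cτ : ℝ} (hτ : ∀ X, ‖τ X‖ ≤ Cτ * ‖X‖) (hCτ : 0 ≤ Cτ) {Mτ : ℝ} (hτm : ∀ X Y : 𝔸, ‖τ (X * Y)‖ ≤ Mτ * ‖X‖ * ‖Y‖) (hMτ : 0 ≤ Mτ)
  {ρw : ℝ} (hρw : 0 ≤ ρw)
  (hτ₁ : ∀ X : 𝔸, τ (star X) = conj (τ X)) (hτ₂ : ∀ X Y : 𝔸, τ (X * Y) = τ (Y * X)) (hφτ : ∀ X Y : 𝔸, ⟪φ.symm X, φ.symm Y⟫_ℂ = τ (star X * Y))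
  (AQ : ℝ)

set_option maxRecDepth 8192 in
set_option maxHeartbeats 1600000 in -- the source's ≈ 80-binder statement, elaborated once more with a `Prop4Hyp` head
include hd hL hL3 hMφ hMφ' hφ hφ' hstar ha ha' hϱ0 hϱ1 hτ hCτ hτm hMτ hρw hτ₁ hτ₂ hφτ in
/-- **PROPOSITION 4 FOR `W80` AT THE TOWER PAIR `(H̃_{1,k}, C_k)`, `Prop4Hyp`-SHAPED, WITH LATTICE-FREE `(C₄, R′)`** — the `SectEDatum.prop4` field's conclusion
`Prop4Hyp (W c) C₄ a₃` at `W c := W80 ρ τc U₀ H̃_{1,k} C_k ε_C J Δ_π`, `a₃ := R′`, `C₄ := C4W M_ρ M_τ M_J M_Δ b C₂ ℓ θ₃ θ_E C_V R′` (every letter chosen before the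
lattice): `∃ α₁ j₁ B δ` FIRST, then — for every height `n+1`, spacing `η` (`ηL^{n+1} = 1`), periods `m`, background `U` on `towerP L m (n+1)` in the GLOBAL
small-field class (#9 `‖U b − 1‖ ≤ αη`, `α ≤ α₁`; #10–#12, #16 — the CLASS-TRANSFER FACE of N06(d = 3)), the positivity of `Δ′_a, Δ_a, G` (#14, Thm 3.11) and the
surjectivity of `Q_k` (#15) making `H̃_{1,k}` a defined object, the (115) carrier data, [Balaban1985Averaging] Prop. 2∕5's numerics for `C_k`, the Sect. C regime of the
pair with its `b` (#19 — the Thm 3.12 letter) and `ε_C + a_C ≤ ρ′`, the weight-ratio bound `ϖ`, the kernel-route window `(ε_C + a_C)ΘΓ ≤ ½`, and the W-slot's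
displayed letters (the V₀-group's slot `(C_V, R_V)`, `‖ρ‖ ≤ M_ρ`, `‖τc‖ ≤ M_τ`, `‖J‖ ≤ M_J`, `‖Δ_π‖ ≤ M_Δ` (#25), `0 < R′ ≤ a_C`, `R′ ≤ (1 − 4bC₂(ε_C + a_C))R_V`) —
`Prop4Hyp (W80 ρ τc U₀ H̃_{1,k} C_k ε_C J Δ_π) C₄ R′`.  Composition: `exists_quadAnalytic_W80_latticeFree` + §1.  Stated for every `d ≥ 1`; R3 reads `d = 3`.
[cite: Balaban1985Variational, Prop. 4 (97)–(98) pp.292–293, (73) p.289, (86)–(89) p.291; Balaban1985Averaging, Prop. 5 (157) p.42; Balaban1985BackgroundPropagators, Thm 3.11 p.416, (3.126) p.420, Thm 3.12 p.423] -/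
theorem exists_prop4Hyp_W80_latticeFree :
    ∃ α₁ j₁ B δ : ℝ, 0 < α₁ ∧ 0 < j₁ ∧ 0 ≤ B ∧ 0 < δ ∧
      ∀ (n : ℕ) (η : ℝ) (_hηL : η * (L : ℝ) ^ (n + 1) = 1) (c₀ c₁ : ℝ) [Fact (0 < c₀)] [Fact (0 < c₁)]
        (_hw : c₀ * ((L : ℝ) ^ (n + 1)) ^ d = c₁) (_hρ : |η| ^ d / c₀ ≤ ρw) (m : Fin d → ℕ) [∀ i, NeZero (m i)] (_hm : ∀ i, 1 ≤ m i)
        (U : Bond d (towerP L m (n + 1)) → 𝔸ˣ) (αU : ℕ → ℝ) (_hα0 : ∀ j, 0 ≤ αU j) (hα1 : ∀ j, αU j ≤ 1 / 64)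
        (hαL : ∀ j, 50 * (d + 1) * αU j * (L : ℝ) ^ d ≤ 1 / 2)
        (hU1 : ∀ (j : ℕ) (x : B7Prop1Explicit.Site d) (k : Fin d), perCfg (towerP L m (j + 1)) (UlevOf L m (n + 1) U j) x k ∈ U1 𝔸)
        (hreg : ∀ (j : ℕ) (y : TSite d (towerP L m j)) (k : Fin d) (ρ' : Fin d → Fin L),
          ‖((Wcx L (perCfg (towerP L m (j + 1)) (UlevOf L m (n + 1) U j)) (cornerSite L y) k (boxVec L ρ') : 𝔸ˣ) : 𝔸) - 1‖ ≤ αU j)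
        (εU : ℕ → ℝ) (_hεU : ∀ j, 0 ≤ εU j) (_hUε : ∀ (j : ℕ) (b : Bond d (towerP L m (j + 1))), ‖(UlevOf L m (n + 1) U j b : 𝔸) - 1‖ ≤ εU j)
        (_hLb : ∀ (j : ℕ) (b : Bond d (towerP L m (j + 1))), UlevOf L m (n + 1) U j b ∈ U1 𝔸)
        (α : ℝ) (_hα : 0 ≤ α) (_hαle : α ≤ α₁)
        (hUst : ∀ b, star (U b : 𝔸) = (((U b)⁻¹ : 𝔸ˣ) : 𝔸)) (_hUb : ∀ b, U b ∈ U1 𝔸) (_hUη : ∀ b, ‖(U b : 𝔸) - 1‖ ≤ α * η)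
        (_hpl : ∀ p : B9SectCLatticeCarrier.Plaq d (towerP L m (n + 1)), ‖(plaqHolU U p : 𝔸) - 1‖ ≤ α * η ^ 2)
        (_hUgrad : ∀ (x : TSite d (towerP L m (n + 1))) (μ : Fin d), ‖(U (x, μ) : 𝔸) - U (unshift μ x, μ)‖ ≤ α * η ^ 2)
        (_hRlev : ∀ (j : ℕ) (b : Bond d (towerP L m (j + 1))) (w : W), ‖adTransportW φ (UlevOf L m (n + 1) U j) b w‖ ≤ ‖w‖)
        (_hεg : ∀ j < n + 1, εU j ≤ α * ϱ ^ j) (_hAQ : ∑ j ∈ Finset.range (n + 1), αU j ≤ AQ)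
        (hpos' : ∀ x : SiteL2K ℂ d (towerP L m (n + 1)) c₀ W, x ≠ 0 → 0 < RCLike.re ⟪x, laplacePrimeAk L m n φ η U a' (c₁ := c₁) x⟫_ℂ)
        (hpos : ∀ x : BondL2K ℂ d (towerP L m (n + 1)) c₀ W, x ≠ 0 →
          0 < RCLike.re ⟪x, laplaceAk L m n φ η U hL αU hα1 hU1 hreg τ (c₀ := c₀) (c₁ := c₁) a x⟫_ℂ)
        (_hc₀η : c₀ = η ^ d) (j₀ : ℝ) (_hJ : ∀ μ y, ‖B9Eq39Adjoint.J (fun μ => B9Eq33CovDerivVector.shiftEquiv μ) (fun μ y => U (y, μ)) η μ y‖ ≤ j₀) (_hj : j₀ ≤ j₁)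
        (hposπ : ∀ x : BondL2K ℂ d (towerP L m (n + 1)) c₀ W, x ≠ 0 →
          0 < RCLike.re ⟪x, laplaceAkPi L m n φ τ η U a' hpos' hL αU hα1 hU1 hreg (c₁ := c₁) a x⟫_ℂ)
        (hQ : Function.Surjective (QkW L m n φ U hL αU hα1 hU1 hreg (c₀ := c₀) (c₁ := c₁)))
        [FiniteDimensional ℂ 𝔸] (lev₀ : Bond d (towerP L m (n + 1)) → ℕ) {κ' : Type*} [Fintype κ'] (lev₁ : κ' → ℕ)
        (Dc : (Bond d (towerP L m (n + 1)) → 𝔸) →ₗ[ℂ] (κ' → 𝔸)) (levB : Bond d m → ℕ) [Fact (0 < (L : ℝ))] [Fact (0 < η)]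
        -- the `C_k`-side data ([Balaban1985Averaging] Prop. 2 on `U`, the levels, the radius `ρ′` of Prop. 5's regime)
        (hL2 : 2 ≤ L) {Gr : Subgroup 𝔸ˣ} (_hGr : AvgClosed d L Gr) (_hUG : ∀ (x : B7Prop1Explicit.Site d) (κ : Fin d), perCfg (towerP L m (n + 1)) U x κ ∈ Gr)
        {α₀ : ℝ} (_hα₀ : 0 < α₀) (_hα3 : C0 d * α₀ ≤ 1 / 3) (_hα4 : 4 * α₀ ≤ c2' d L)
        (_h52 : pdev (perCfg (towerP L m (n + 1)) U) < α₀ * (((L : ℝ) ^ (n + 1))⁻¹) ^ 2) (_hlev : ∀ b, n + 1 ≤ lev₀ b) {ρ' : ℝ}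
        (_hρ' : Real.exp (4 * (800 * ((d : ℝ) + 1) ^ 2 * ((d : ℝ) + 4)) * α₀) * (1 + 8 * (131072 * ((d : ℝ) + 1) ^ 2) * ρ') ≤ 2)
        (_hρ'4 : 4 * ρ' ≤ c3 d L) (_hθ : 2 * d * thetaGen d L α₀ ≤ (L : ℝ) ^ 3 / 16) (_hC3 : 2 * d * C3Gen d L * ρ' ≤ 1)
        -- the Sect. C regime of the pair `(H̃_{1,k}, C_k)` (its `b` is the [Balaban1985BackgroundPropagators] Thm 3.12 letter) and the kernel-route window
        {b aC εC : ℝ} (_RC : Regime (H1LatticeCLM (L := (L : ℝ)) (η := η) (lev₀ := lev₀) (levB := levB) φ hposπ hQ lev₁ Dc) 0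
          (Cck L m η (n + 1) U lev₀ lev₁ Dc levB) b 0 (C2T d α₀) ρ' 0 aC εC)
        (_haC : 0 < aC) (_hεa : εC + aC ≤ ρ') {ϖ : ℝ} (_hϖ0 : 0 ≤ ϖ)
        (_hϖ : ∀ bb b' : Bond d (towerP L m (n + 1)), levWeight (L : ℝ) η lev₀ 3 bb / levWeight (L : ℝ) η lev₀ 3 b' ≤ ϖ)
        (_hq : (εC + aC) * (Mφ * B * Mφ' * (d * latticeConst d δ)) * (C3Gen d L * (2 ^ d * (2 * d))) ≤ 1 / 2)
        -- the W-slot's displayed letters: the V₀-group's slot, the fibre maps, the currents, the radius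
        {CV RV Mρ Mτ MJ MΔ : ℝ} (_hCV : 0 ≤ CV) (_hRV : 0 < RV) (_hMρ : 0 ≤ Mρ) (_hMτ : 0 ≤ Mτ) (_hMJ : 0 ≤ MJ) (_hMΔ : 0 ≤ MΔ)
        {R' : ℝ} (_hR'0 : 0 < R') (_hR'a : R' ≤ aC) (_hR'V : R' ≤ (1 - 4 * b * C2T d α₀ * (εC + aC)) * RV)
        (ρ : (𝔸 →L[ℂ] ℂ) →L[ℂ] 𝔸) (τc : 𝔸 →L[ℂ] ℂ) (U₀ : Bond d (towerP L m (n + 1)) → 𝔸ˣ) (_hρ : ‖ρ‖ ≤ Mρ) (_hτc : ‖τc‖ ≤ Mτ)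
        (_hqV : ∀ Y : Space115 (L : ℝ) η lev₀ lev₁ Dc, ‖Y‖ < RV → ‖curV0 (lev₁ := lev₁) (Dc := Dc) ρ τc U₀ Y‖ ≤ CV * ‖Y‖ ^ 2)
        (J : NegSize (L : ℝ) η lev₀ 3 𝔸) (Δπ : Space115 (L : ℝ) η lev₀ lev₁ Dc →L[ℂ] NegSize (L : ℝ) η lev₀ 3 𝔸) (_hJ : ‖J‖ ≤ MJ) (_hΔ : ‖Δπ‖ ≤ MΔ),
        Prop4Hyp (W80 ρ τc U₀ (H1LatticeCLM (L := (L : ℝ)) (η := η) (lev₀ := lev₀) (levB := levB) φ hposπ hQ lev₁ Dc)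
            (Cck L m η (n + 1) U lev₀ lev₁ Dc levB) εC J Δπ)
          (C4W Mρ Mτ MJ MΔ b (C2T d α₀) (1 / (1 - 4 * b * C2T d α₀ * (εC + aC)))
            ((2 * (1 / (1 - 4 * b * C2T d α₀ * (εC + aC))) + 1) * (ϖ * (Mφ * B * Mφ' * (d * latticeConst d δ))) * (C3Gen d L * (2 ^ d * (2 * d))) / aC)
            (2 * (ϖ * (Mφ * B * Mφ' * (d * latticeConst d δ))) * (C3Gen d L * (2 ^ d * (2 * d))) * (1 / (1 - 4 * b * C2T d α₀ * (εC + aC)))) CV R') R' := by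
  obtain ⟨α₁, j₁, B, δ, hα₁, hj₁, hB, hδ, H⟩ :=
    exists_quadAnalytic_W80_latticeFree hd L hL hL3 φ hMφ hMφ' hφ hφ' hstar ha ha' hϱ0 hϱ1 τ hτ hCτ hτm hMτ hρw hτ₁ hτ₂ hφτ AQ
  refine ⟨α₁, j₁, B, δ, hα₁, hj₁, hB, hδ, ?_⟩
  intro n η hηL c₀ c₁ _ _ hw hρ m _ hm U αU hα0 hα1 hαL hU1 hreg εU hεU hUε hLb α hα hαle hUst hUb hUη hpl hUgrad hRlev hεg hAQ hpos' hpos hc₀η j₀ hJ hj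
    hposπ hQ _ lev₀ κ' _ lev₁ Dc levB _ _ hL2 Gr hGr hUG α₀ hα₀ hα3 hα4 h52 hlev ρ' hρ' hρ'4 hθ hC3 b aC εC RC haC hεa ϖ hϖ0 hϖ hq
    CV RV Mρ Mτ MJ MΔ hCV hRV hMρ hMτ hMJ hMΔ R' hR'0 hR'a hR'V ρ τc U₀ hρn hτn hqV J Δπ hJn hΔn
  obtain ⟨hq98, han⟩ := H n η hηL c₀ c₁ hw hρ m hm U αU hα0 hα1 hαL hU1 hreg εU hεU hUε hLb α hα hαle hUst hUb hUη hpl hUgrad hRlev hεg hAQ hpos' hpos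
    hc₀η j₀ hJ hj hposπ hQ lev₀ lev₁ Dc levB hL2 hGr hUG hα₀ hα3 hα4 h52 hlev hρ' hρ'4 hθ hC3 RC haC hεa hϖ0 hϖ hq hCV hRV hMρ hMτ hMJ hMΔ hR'0 hR'a hR'V
    ρ τc U₀ hρn hτn hqV J Δπ hJn hΔn
  exact prop4Hyp_of_quadAnalytic_of_analyticOnNhd hq98 han

/-! ## §3 The same on the `SectEDatum`'s own carrier (`Dc := ∇_{U}`, `U₀ := U`, `J := Jcur U`) with the TREE rows discharged -/

set_option maxRecDepth 8192 in
set_option maxHeartbeats 1600000 in -- §2's statement once more, the V₀-slot and the current letter computed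
include hd hL hL3 hMφ hMφ' hφ hφ' hstar ha ha' hϱ0 hϱ1 hτ hCτ hτm hMτ hρw hτ₁ hτ₂ hφτ in
/-- **THE `prop4` FIELD IN N06 CURRENCY AT THE DATUM's OWN CARRIER** — §2 read at `κ′ := Bond × Fin d`, `Dc := nabla115 η U` (the covariant gradient OF THE
BACKGROUND, as `SectEDatum` indexes (115)), `U₀ := U` (census #27) and `J := Jcur U` (the CONCRETE current (27)/(28)), with the TREE rows DISCHARGED by name:
the V₀-group's (98)-slot (#22) by `B11Eq98V0LettersLatticeUniform.curV0_quadBound_lattice_uniform` at `R_V = 1/16` with the closed-form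
`C_V = 1024(d−1)(ωΩ)³M_ρ(ω² + 1/16) + (d−1)(ωΩ)³(136 + 2ωΩ)M_ρ` (for a tracial, ⋆-compatible, contractive `τc`; `α ≤ 1`, whence the exported threshold
`min α₁ 1`), the current letter (#24) `‖Jcur U‖₍₋₃₎ ≤ ω³` by `B11Eq28JcurWindow.norm_Jcur_le_of_window` from the current window #16 (exported `min j₁ 1`), and the
`lev₀`-profile letter `w̲₀⁻¹ ≤ 1 ≤ Ω` from `j(b) ≥ n+1`, `L^{n+1}η = 1`.  REMAINING DISPLAYED: the CLASS rows (#9–#12, #16), the N06 rows (#14 positivity, #19 the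
regime with its `b`, #25 `‖Δ_π‖ ≤ M_Δ`), the profile bounds `w̄₀ ≤ ω`, `w̲₁,₂⁻¹ ≤ Ω`, the weight ratio `ϖ`, the fibre map `ρ` (`‖ρ‖ ≤ M_ρ`) and the radius `R′`.
Conclusion: `Prop4Hyp (W80 ρ τc U H̃_{1,k} C_k ε_C (Jcur U) Δ_π) (C4W M_ρ 1 ω³ M_Δ b C₂ ℓ θ₃ θ_E C_V R′) R′`. [folklore]
[cite: Balaban1985Variational, Prop. 4 (97)–(98) pp.292–293, (27)–(28) p.282, (90)–(96) pp.291–292; Balaban1985BackgroundPropagators, (3.35)–(3.36) p.396, Thm 3.12 p.423] -/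
theorem exists_prop4Hyp_W80_latticeFree_V0Jcur :
    ∃ α₁ j₁ B δ : ℝ, 0 < α₁ ∧ 0 < j₁ ∧ 0 ≤ B ∧ 0 < δ ∧
      ∀ (n : ℕ) (η : ℝ) (_hηL : η * (L : ℝ) ^ (n + 1) = 1) (c₀ c₁ : ℝ) [Fact (0 < c₀)] [Fact (0 < c₁)]
        (_hw : c₀ * ((L : ℝ) ^ (n + 1)) ^ d = c₁) (_hρ : |η| ^ d / c₀ ≤ ρw) (m : Fin d → ℕ) [∀ i, NeZero (m i)] (_hm : ∀ i, 1 ≤ m i)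
        (U : Bond d (towerP L m (n + 1)) → 𝔸ˣ) (αU : ℕ → ℝ) (_hα0 : ∀ j, 0 ≤ αU j) (hα1 : ∀ j, αU j ≤ 1 / 64)
        (hαL : ∀ j, 50 * (d + 1) * αU j * (L : ℝ) ^ d ≤ 1 / 2)
        (hU1 : ∀ (j : ℕ) (x : B7Prop1Explicit.Site d) (k : Fin d), perCfg (towerP L m (j + 1)) (UlevOf L m (n + 1) U j) x k ∈ U1 𝔸)
        (hreg : ∀ (j : ℕ) (y : TSite d (towerP L m j)) (k : Fin d) (ρ' : Fin d → Fin L),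
          ‖((Wcx L (perCfg (towerP L m (j + 1)) (UlevOf L m (n + 1) U j)) (cornerSite L y) k (boxVec L ρ') : 𝔸ˣ) : 𝔸) - 1‖ ≤ αU j)
        (εU : ℕ → ℝ) (_hεU : ∀ j, 0 ≤ εU j) (_hUε : ∀ (j : ℕ) (b : Bond d (towerP L m (j + 1))), ‖(UlevOf L m (n + 1) U j b : 𝔸) - 1‖ ≤ εU j)
        (_hLb : ∀ (j : ℕ) (b : Bond d (towerP L m (j + 1))), UlevOf L m (n + 1) U j b ∈ U1 𝔸)
        (α : ℝ) (_hα : 0 ≤ α) (_hαle : α ≤ α₁)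
        (hUst : ∀ b, star (U b : 𝔸) = (((U b)⁻¹ : 𝔸ˣ) : 𝔸)) (_hUb : ∀ b, U b ∈ U1 𝔸) (_hUη : ∀ b, ‖(U b : 𝔸) - 1‖ ≤ α * η)
        (_hpl : ∀ p : B9SectCLatticeCarrier.Plaq d (towerP L m (n + 1)), ‖(plaqHolU U p : 𝔸) - 1‖ ≤ α * η ^ 2)
        (_hUgrad : ∀ (x : TSite d (towerP L m (n + 1))) (μ : Fin d), ‖(U (x, μ) : 𝔸) - U (unshift μ x, μ)‖ ≤ α * η ^ 2)
        (_hRlev : ∀ (j : ℕ) (b : Bond d (towerP L m (j + 1))) (w : W), ‖adTransportW φ (UlevOf L m (n + 1) U j) b w‖ ≤ ‖w‖)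
        (_hεg : ∀ j < n + 1, εU j ≤ α * ϱ ^ j) (_hAQ : ∑ j ∈ Finset.range (n + 1), αU j ≤ AQ)
        (hpos' : ∀ x : SiteL2K ℂ d (towerP L m (n + 1)) c₀ W, x ≠ 0 → 0 < RCLike.re ⟪x, laplacePrimeAk L m n φ η U a' (c₁ := c₁) x⟫_ℂ)
        (hpos : ∀ x : BondL2K ℂ d (towerP L m (n + 1)) c₀ W, x ≠ 0 →
          0 < RCLike.re ⟪x, laplaceAk L m n φ η U hL αU hα1 hU1 hreg τ (c₀ := c₀) (c₁ := c₁) a x⟫_ℂ)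
        (_hc₀η : c₀ = η ^ d) (j₀ : ℝ) (_hJ : ∀ μ y, ‖B9Eq39Adjoint.J (fun μ => B9Eq33CovDerivVector.shiftEquiv μ) (fun μ y => U (y, μ)) η μ y‖ ≤ j₀) (_hj : j₀ ≤ j₁)
        (hposπ : ∀ x : BondL2K ℂ d (towerP L m (n + 1)) c₀ W, x ≠ 0 →
          0 < RCLike.re ⟪x, laplaceAkPi L m n φ τ η U a' hpos' hL αU hα1 hU1 hreg (c₁ := c₁) a x⟫_ℂ)
        (hQ : Function.Surjective (QkW L m n φ U hL αU hα1 hU1 hreg (c₀ := c₀) (c₁ := c₁)))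
        [FiniteDimensional ℂ 𝔸] (lev₀ : Bond d (towerP L m (n + 1)) → ℕ) (lev₁ : Bond d (towerP L m (n + 1)) × Fin d → ℕ)
        (levB : Bond d m → ℕ) [Fact (0 < (L : ℝ))] [Fact (0 < η)]
        -- the `C_k`-side data ([Balaban1985Averaging] Prop. 2 on `U`, the levels, the radius `ρ′` of Prop. 5's regime)
        (hL2 : 2 ≤ L) {Gr : Subgroup 𝔸ˣ} (_hGr : AvgClosed d L Gr) (_hUG : ∀ (x : B7Prop1Explicit.Site d) (κ : Fin d), perCfg (towerP L m (n + 1)) U x κ ∈ Gr)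
        {α₀ : ℝ} (_hα₀ : 0 < α₀) (_hα3 : C0 d * α₀ ≤ 1 / 3) (_hα4 : 4 * α₀ ≤ c2' d L)
        (_h52 : pdev (perCfg (towerP L m (n + 1)) U) < α₀ * (((L : ℝ) ^ (n + 1))⁻¹) ^ 2) (hlev : ∀ b, n + 1 ≤ lev₀ b) {ρ' : ℝ}
        (_hρ' : Real.exp (4 * (800 * ((d : ℝ) + 1) ^ 2 * ((d : ℝ) + 4)) * α₀) * (1 + 8 * (131072 * ((d : ℝ) + 1) ^ 2) * ρ') ≤ 2)
        (_hρ'4 : 4 * ρ' ≤ c3 d L) (_hθ : 2 * d * thetaGen d L α₀ ≤ (L : ℝ) ^ 3 / 16) (_hC3 : 2 * d * C3Gen d L * ρ' ≤ 1)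
        -- the Sect. C regime of the pair `(H̃_{1,k}, C_k)` (its `b` is the [Balaban1985BackgroundPropagators] Thm 3.12 letter) and the kernel-route window
        {b aC εC : ℝ} (_RC : Regime (H1LatticeCLM (L := (L : ℝ)) (η := η) (lev₀ := lev₀) (levB := levB) φ hposπ hQ lev₁ (nabla115 η U)) 0
          (Cck L m η (n + 1) U lev₀ lev₁ (nabla115 η U) levB) b 0 (C2T d α₀) ρ' 0 aC εC)
        (_haC : 0 < aC) (_hεa : εC + aC ≤ ρ') {ϖ : ℝ} (_hϖ0 : 0 ≤ ϖ)
        (_hϖ : ∀ bb b' : Bond d (towerP L m (n + 1)), levWeight (L : ℝ) η lev₀ 3 bb / levWeight (L : ℝ) η lev₀ 3 b' ≤ ϖ)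
        (_hq : (εC + aC) * (Mφ * B * Mφ' * (d * latticeConst d δ)) * (C3Gen d L * (2 ^ d * (2 * d))) ≤ 1 / 2)
        -- the (115) weight-profile bounds, the fibre maps (a tracial ⋆-compatible contractive `τc`), `Δ_π`, the radius
        {ω Ω : ℝ} (hω1 : 1 ≤ ω) (hΩ1 : 1 ≤ Ω) (hw₀ : (NegSup.wSup (levWeight (L : ℝ) η lev₀ 1) : ℝ) ≤ ω)
        (hΩ₁ : (NegSup.wInvSup (levWeight (L : ℝ) η lev₁ 2) : ℝ) ≤ Ω)
        {Mρ MΔ : ℝ} (hMρ : 0 ≤ Mρ) (_hMΔ : 0 ≤ MΔ)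
        {R' : ℝ} (_hR'0 : 0 < R') (_hR'a : R' ≤ aC) (_hR'V : R' ≤ (1 - 4 * b * C2T d α₀ * (εC + aC)) * (1 / 16))
        (ρ : (𝔸 →L[ℂ] ℂ) →L[ℂ] 𝔸) (τc : 𝔸 →L[ℂ] ℂ) (_hρ : ‖ρ‖ ≤ Mρ)
        (hτc2 : ∀ X Y : 𝔸, τc (X * Y) = τc (Y * X)) (hτcs : ∀ X : 𝔸, τc (star X) = starRingEnd ℂ (τc X)) (hτc1 : ∀ X : 𝔸, ‖τc X‖ ≤ ‖X‖)
        (Δπ : Space115 (L : ℝ) η lev₀ lev₁ (nabla115 η U) →L[ℂ] NegSize (L : ℝ) η lev₀ 3 𝔸) (_hΔ : ‖Δπ‖ ≤ MΔ),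
        Prop4Hyp (W80 ρ τc U (H1LatticeCLM (L := (L : ℝ)) (η := η) (lev₀ := lev₀) (levB := levB) φ hposπ hQ lev₁ (nabla115 η U))
            (Cck L m η (n + 1) U lev₀ lev₁ (nabla115 η U) levB) εC (Jcur (L := (L : ℝ)) (η := η) (lev₀ := lev₀) U) Δπ)
          (C4W Mρ 1 (ω ^ 3) MΔ b (C2T d α₀) (1 / (1 - 4 * b * C2T d α₀ * (εC + aC)))
            ((2 * (1 / (1 - 4 * b * C2T d α₀ * (εC + aC))) + 1) * (ϖ * (Mφ * B * Mφ' * (d * latticeConst d δ))) * (C3Gen d L * (2 ^ d * (2 * d))) / aC)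
            (2 * (ϖ * (Mφ * B * Mφ' * (d * latticeConst d δ))) * (C3Gen d L * (2 ^ d * (2 * d))) * (1 / (1 - 4 * b * C2T d α₀ * (εC + aC))))
            (1024 * ((d - 1 : ℕ) : ℝ) * (ω * Ω) ^ 3 * Mρ * (1 * 1 * ω ^ 2 + 1 / 16) + ((d - 1 : ℕ) : ℝ) * (ω * Ω) ^ 3 * (136 + 2 * (ω * Ω)) * Mρ * 1)
            R') R' := by
  obtain ⟨α₁, j₁, B, δ, hα₁, hj₁, hB, hδ, H⟩ :=
    exists_prop4Hyp_W80_latticeFree hd L hL hL3 φ hMφ hMφ' hφ hφ' hstar ha ha' hϱ0 hϱ1 τ hτ hCτ hτm hMτ hρw hτ₁ hτ₂ hφτ AQ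
  refine ⟨min α₁ 1, min j₁ 1, B, δ, lt_min hα₁ one_pos, lt_min hj₁ one_pos, hB, hδ, ?_⟩
  intro n η hηL c₀ c₁ _ _ hw hρ m _ hm U αU hα0 hα1 hαL hU1 hreg εU hεU hUε hLb α hα hαle hUst hUb hUη hpl hUgrad hRlev hεg hAQ hpos' hpos hc₀η j₀ hJ hj
    hposπ hQ _ lev₀ lev₁ levB _ _ hL2 Gr hGr hUG α₀ hα₀ hα3 hα4 h52 hlev ρ' hρ' hρ'4 hθ hC3 b aC εC RC haC hεa ϖ hϖ0 hϖ hq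
    ω Ω hω1 hΩ1 hw₀ hΩ₁ Mρ MΔ hMρ hMΔ R' hR'0 hR'a hR'V ρ τc hρn hτc2 hτcs hτc1 Δπ hΔn
  have hη0 : 0 < η := Fact.out
  have hL1 : (1 : ℝ) ≤ (L : ℝ) := by exact_mod_cast hL
  have hαle₁ : α ≤ α₁ := hαle.trans (min_le_left _ _)
  have hαle1 : α ≤ 1 := hαle.trans (min_le_right _ _)
  have hj₁' : j₀ ≤ j₁ := hj.trans (min_le_left _ _)
  have hj1 : j₀ ≤ 1 := hj.trans (min_le_right _ _)
  have hω0 : 0 < ω := lt_of_lt_of_le one_pos hω1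
  have hΩ0 : 0 < Ω := lt_of_lt_of_le one_pos hΩ1
  -- the contractive trace as an operator of norm `≤ 1`
  have hτn : ‖τc‖ ≤ 1 := ContinuousLinearMap.opNorm_le_bound _ zero_le_one fun X => by simpa only [one_mul] using hτc1 X
  -- the `lev₀`-profile letter `w̲₀⁻¹ ≤ 1 ≤ Ω` from `j(b) ≥ n+1`, `L^{n+1}η = 1`
  have hΩ₀ : (NegSup.wInvSup (levWeight (L : ℝ) η lev₀ 1) : ℝ) ≤ Ω := by
    have h : NegSup.wInvSup (levWeight (L : ℝ) η lev₀ 1) ≤ 1 :=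
      Finset.sup_le fun bb _ => by
        refine inv_le_one_of_one_le₀ ?_
        rw [← NNReal.coe_le_coe, NegSup.coe_wNN (w := levWeight (L : ℝ) η lev₀ 1), levWeight_apply, pow_one, NNReal.coe_one]
        calc (1 : ℝ) = (L : ℝ) ^ (n + 1) * η := by rw [mul_comm]; exact hηL.symm
          _ ≤ (L : ℝ) ^ lev₀ bb * η := mul_le_mul_of_nonneg_right (pow_le_pow_right₀ hL1 (hlev bb)) hη0.le
    have h' : ((NegSup.wInvSup (levWeight (L : ℝ) η lev₀ 1) : NNReal) : ℝ) ≤ 1 := by exact_mod_cast h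
    exact h'.trans hΩ1
  -- the V₀-group's (98)-slot, SUPPLIED lattice-free (`R_V = 1/16`)
  obtain ⟨CV, hCVdef⟩ : ∃ CV : ℝ, CV = 1024 * ((d - 1 : ℕ) : ℝ) * (ω * Ω) ^ 3 * Mρ * (1 * 1 * ω ^ 2 + 1 / 16)
      + ((d - 1 : ℕ) : ℝ) * (ω * Ω) ^ 3 * (136 + 2 * (ω * Ω)) * Mρ * 1 := ⟨_, rfl⟩
  have hCV : 0 ≤ CV := by rw [hCVdef]; positivity
  have hqV : ∀ Y : Space115 (L : ℝ) η lev₀ lev₁ (nabla115 η U), ‖Y‖ < 1 / 16 →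
      ‖curV0 (lev₁ := lev₁) (Dc := nabla115 η U) ρ τc U Y‖ ≤ CV * ‖Y‖ ^ 2 := by
    intro Y hY
    refine (curV0_quadBound_lattice_uniform (L := (L : ℝ)) (η := η) (lev₀ := lev₀) (lev₁ := lev₁) ρ τc hτc2 hτcs hτc1 hL1 hUb hUst hα hpl hω1 hΩ1
      hw₀ hΩ₀ hΩ₁ Y hY).trans ?_
    rw [hCVdef]
    have hρ0 : 0 ≤ ‖ρ‖ := norm_nonneg ρ
    have hτ0 : 0 ≤ ‖τc‖ := norm_nonneg τc
    gcongr
  -- the current letter `M_J := ω³` from the window `j₀ ≤ 1` and the profile bound `w̄₀ ≤ ω`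
  have hJn : ‖Jcur (L := (L : ℝ)) (η := η) (lev₀ := lev₀) U‖ ≤ ω ^ 3 := by
    have hj0 : (0 : ℝ) ≤ max j₀ 0 := le_max_right _ _
    have hJ' : ∀ μ y, ‖B9Eq39Adjoint.J (fun μ => B9Eq33CovDerivVector.shiftEquiv μ) (fun μ y => U (y, μ)) η μ y‖ ≤ max j₀ 0 :=
      fun μ y => (hJ μ y).trans (le_max_left _ _)
    have hwb : ∀ bb, levWeight (L : ℝ) η lev₀ 1 bb ≤ ω := fun bb => (NegSup.le_wSup (w := levWeight (L : ℝ) η lev₀ 1) bb).trans hw₀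
    have h := norm_Jcur_le_of_window (𝔸 := 𝔸) (L : ℝ) U hj0 (by positivity) (levWeight_three_le (L : ℝ) hwb) hJ'
    refine h.trans ?_
    have h1 : max j₀ 0 ≤ 1 := max_le hj1 zero_le_one
    calc ω ^ 3 * max j₀ 0 ≤ ω ^ 3 * 1 := by gcongr
      _ = ω ^ 3 := mul_one _
  have h := H n η hηL c₀ c₁ hw hρ m hm U αU hα0 hα1 hαL hU1 hreg εU hεU hUε hLb α hα hαle₁ hUst hUb hUη hpl hUgrad hRlev hεg hAQ hpos' hpos
    hc₀η j₀ hJ hj₁' hposπ hQ lev₀ lev₁ (nabla115 η U) levB hL2 hGr hUG hα₀ hα3 hα4 h52 hlev hρ' hρ'4 hθ hC3 RC haC hεa hϖ0 hϖ hq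
    hCV (by norm_num : (0 : ℝ) < 1 / 16) hMρ zero_le_one (by positivity : (0 : ℝ) ≤ ω ^ 3) hMΔ hR'0 hR'a hR'V
    ρ τc U hρn hτn hqV (Jcur (L := (L : ℝ)) (η := η) (lev₀ := lev₀) U) Δπ hJn hΔn
  rw [hCVdef] at h
  exact h

end Displayed

end Summit.QuantumFields.YangMills.Theorems.Prop7SectET3Prop4

end
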